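/-
Copyright (c) 2026. All rights reserved.
Released under Apache 2.0 license as described in the file LICENSE.
Authors: abc-iut cell, wave-5 seat abc-iut-w5-d141 (L3 sub-DAG [SemiAnbd] Thm 5.4, umbrella junction v5: the datum `ι g`
through the charts, parametric in a dictionary).
-/
import Literature.AnabelianGeometry.SemiGraphs.ArithIotaShadowsTransport
import Literature.AnabelianGeometry.SemiGraphs.TemperedFunctorialityWithHom
import HarnessLib

/-!
# [SemiAnbd] Theorem 5.4 (iii), compatible reading: the datum `ι g = B^temp(g)|_{Ker}` READ THROUGH THE CHARTS,
# and its Prop 5.2 (iv) dictionary DERIVED from a dictionary of arrows (proof-only)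

Mochizuki, *Semi-graphs of anabelioids*, Publ. RIMS **42** (2006), §5, Theorem 5.4 (iii) p. 66 ("Applying
`B^temp(−)` … the proofs are entirely parallel to those of Theorem 3.7, Corollary 3.9"), Prop 5.2 (iv) p. 64, p. 65;
§3 Prop 3.2 p. 35, Prop 3.6 (iv) p. 39 [cite: MochizukiSemiAnbd2006, Thm 5.4 (iii), p. 66].

PROOF-ONLY (no definition, nothing asserted; cell abc-iut, layer L3, T54 junction, abc-iut-w4-d053's «ι g SHAPE RULING»
2026-08-26).  The Thm 5.4 (iii) umbrella (`ArithThm54iiiUmbrellaOfChart.lean`, v4) carries an ABSTRACT datum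
`ι g : Ker aug_𝔊 → Π^temp_ℍ` ("`B^temp(g)` on the geometric tempered groups") for every arrow `g : 𝔾 → ℍ'` of the
container, with eight properties.  Here `ι g` is READ THROUGH THE CHARTS: for chart-level representatives
`φ̂ g : π₁^temp(𝔾) → π₁^temp(ℍ')` (Prop 3.2) one has homomorphisms `ι g` with `ι g (ι_𝔾 y) = ι_ℍ (φ̂ g y)`
(`exists_iotaFamily_of_charts`; `ι_𝔾`, `ι_ℍ` the producer's embeddings with `range = Ker`, Prop 5.2 (iv)), and for ANY
such `ι` the umbrella's binders are THEOREMS of a DICTIONARY `dict g : Hom 𝔾 ℍ'` (abc-iut-L3-t2's morphisms of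
semi-graphs of anabelioids) WITH CHOSEN 2-CELLS `θ g` (Rmk 2.4.2; the pull-back functor depends on them, cell finding
RQ12) representing `φ̂ g` (`(dict g)^*_{θ g} ≅ B^temp(φ̂ g)`, abc-iut-L3-t10's `Hom.chartPullbackWith`):
* `iotaShadows_of_dict` — `hιgeomV`/`hιgeomE`/`hιgeomC` (abc-iut-w4-d083's `iotaShadows_of_compatVAt`, the
  compatibilities `CompatV`/`CompatE` being abc-iut-L3-t10's `Hom.conj_of_chartPullbackWith_iso(_edge)`);
* `hCor39c_of_dict` — the junction binder `hCor39c` INCLUDING its last line (abc-iut-w4-d083's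
  `exists_hom_chartPullbackWith_iso_of_kernelShadows` + the dictionary is FULL on locally open arrows + Prop 3.2
  `BTemp.exists_conj_of_natTrans`);
* `hιinj_of_dict` — injectivity (the dictionary is FAITHFUL up to 2-isomorphism + `BTemp.resIsoOfConj`);
* `hιG_of_dict` / `hιH_of_dict` — the arithmetic twists (functoriality 2-isomorphisms of the dictionary with the graph
  actions `F_𝔾`, `F_ℍ` of `Π_A` + «conjugation by `γ ∈ Π^temp_𝔊` on `ι_𝔾(π₁^temp 𝔾)` represents `(F_𝔾 (aug γ))^*`», the
  Hom-level form of `ArithChartAction.conj_verticial`; + `BTemp.resComp`, `BTemp.exists_conj_of_natTrans`);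
* `hιbtemp_of_charts` — `hιbtemp` from its chart-currency form «`B^temp(φ) ∘ ι_𝔾 = ι_ℍ ∘ φ̂_{φ_𝔾}` up to
  `Ker(aug_ℍ)`-conjugacy».
The dictionary binders are the cell's recorded merge debt (container `SemiAnbdVocab` ↔ `ProfiniteSemiGraph.Hom`,
BridgeResidual (R1)); nothing asserted for real tempered data; nothing here bears on [IUTchIII] Cor. 3.12; typed ≠ proved.
-/

namespace Literature.AnabelianGeometry.SemiGraphs

namespace ProfiniteSemiGraph

open _root_.CategoryTheory _root_.Topology

universe u uG uH uP uI

variable {𝒢 ℋ : ProfiniteSemiGraph.{u}} {c𝒢 : TemperedPiChart 𝒢} {cℋ : TemperedPiChart ℋ}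
variable {Gtp : Type uG} [Group Gtp] {Htp : Type uH} [Group Htp]
variable {PA : Type uP} [Group PA] [TopologicalSpace PA] {I : Type uI}

/-! ### The datum `ι g` through the charts -/

/-- **`ι g` read through the charts exists**: for `ι_𝔾 : π₁^temp(𝔾) ↪ Π^temp_𝔊` injective with range `N`
(`= Ker aug_𝔊`, Prop 5.2 (iv)) and any family of chart-level homomorphisms `φ̂ g : π₁^temp(𝔾) → π₁^temp(ℍ')`, there
are homomorphisms `ι g : N → Π^temp_ℍ` with `ι g (ι_𝔾 y) = ι_ℍ (φ̂ g y)` — namely `ι_ℍ ∘ φ̂ g ∘ ι_𝔾⁻¹`.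
[cite: MochizukiSemiAnbd2006, Thm 5.4 (iii), p. 66] -/
theorem exists_iotaFamily_of_charts (ι𝒢 : c𝒢.G →* Gtp) (hι𝒢 : Function.Injective ι𝒢) (N : Subgroup Gtp)
    (hN : ι𝒢.range = N) (ιℋ : cℋ.G →* Htp) (φ : I → (c𝒢.G →* cℋ.G)) :
    ∃ ι : I → (N →* Htp), ∀ (i : I) (x : N) (y : c𝒢.G), (x : Gtp) = ι𝒢 y → ι i x = ιℋ (φ i y) := by
  subst hN
  refine ⟨fun i => ιℋ.comp ((φ i).comp (MonoidHom.ofInjective hι𝒢).symm.toMonoidHom), fun i x y hxy => ?_⟩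
  have hx : x = MonoidHom.ofInjective hι𝒢 y := Subtype.ext (by rw [hxy, MonoidHom.ofInjective_apply])
  subst hx
  simp only [MonoidHom.coe_comp, MulEquiv.coe_toMonoidHom, Function.comp_apply, MulEquiv.symm_apply_apply]

/-! ### `hιgeomV` / `hιgeomE` / `hιgeomC` -/

/-- **The three kernel-level shadows of `ι g` from the dictionary** (`hιgeomV`, `hιgeomE`, `hιgeomC` of the
umbrella, verbatim shapes): if `φ̂` represents the pull-back functor of a LOCALLY OPEN `F : 𝔾 → ℍ'` with chosen
2-cells `θ` (`F^*_θ ≅ B^temp(φ̂)`), then `φ̂` is compatible with `F` on verticial and edge homomorphisms (Prop 3.6 (iv),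
`Hom.conj_of_chartPullbackWith_iso(_edge)`) and abc-iut-w4-d083's `iotaShadows_of_compatVAt` applies to any `ι g`
agreeing with `φ̂` through the embeddings — modulo Thm 3.7 (iii) at `𝔾` and at `ℍ'`.
[cite: MochizukiSemiAnbd2006, Thm 5.4 (iii), p. 66] -/
theorem iotaShadows_of_dict [TopologicalSpace Htp] (h𝒢iii : CompactInVerticialAt 𝒢)
    (hℋiii : CompactInVerticialAt ℋ) (h𝒢 : Cor39Hypotheses 𝒢) (hℋ : Cor39Hypotheses ℋ)
    (R : ChartRepresentatives c𝒢) (R' : ChartRepresentatives cℋ) (ι𝒢 : c𝒢.G →* Gtp) (ιℋ : cℋ.G →* Htp)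
    (hι𝒢 : Function.Injective ι𝒢) (hιℋ : Function.Injective ιℋ) (hιℋe : IsEmbedding ιℋ)
    (augG : Gtp →* PA) (augH' : Htp →* PA) (hex𝒢 : ι𝒢.range = augG.ker) (hexℋ : ιℋ.range = augH'.ker)
    {actV : PA → 𝒢.graph.Vertex → 𝒢.graph.Vertex} {actE : PA → 𝒢.graph.Edge → 𝒢.graph.Edge}
    {actB : PA → 𝒢.graph.Branch → 𝒢.graph.Branch} (A𝒢 : ArithChartAction c𝒢 ι𝒢 augG actV actE actB)
    (F : Hom 𝒢 ℋ) (θ : F.ConjugatorFamily) (hF : F.IsLocallyOpen) (φ : c𝒢.G →ₜ* cℋ.G)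
    (hφ : Nonempty (F.chartPullbackWith θ c𝒢 cℋ ≅ BTemp.res φ)) (ιg : augG.ker →* Htp)
    (hιg : ∀ (x : augG.ker) (y : c𝒢.G), (x : Gtp) = ι𝒢 y → ιg x = ιℋ (φ y)) :
    (∃ fv : 𝒢.graph.Vertex → ℋ.graph.Vertex, ∀ v : 𝒢.graph.Vertex, ∃ x : Htp,
      MapsOntoOpenSubgroupOf ιg
        (((decompositionDataOfChart R ι𝒢).vertGp v ⊓ augG.ker).subgroupOf augG.ker)
        (conjSubgroup x ((decompositionDataOfChart R' ιℋ).vertGp (fv v)) ⊓ augH'.ker)) ∧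
    (∃ fb : 𝒢.graph.Branch → ℋ.graph.Branch, ∀ b : 𝒢.graph.Branch, ∃ x : Htp,
      MapsOntoOpenSubgroupOf ιg
        (((decompositionDataOfChart R ι𝒢).brGp b ⊓ augG.ker).subgroupOf augG.ker)
        (conjSubgroup x ((decompositionDataOfChart R' ιℋ).brGp (fb b)) ⊓ augH'.ker)) ∧
    (∀ (v₁ v₂ : 𝒢.graph.Vertex) (γ₁ γ₂ : Gtp),
      conjSubgroup γ₁ ((decompositionDataOfChart R ι𝒢).vertGp v₁) ⊓ augG.ker ≠
          conjSubgroup γ₂ ((decompositionDataOfChart R ι𝒢).vertGp v₂) ⊓ augG.ker →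
      conjSubgroup γ₁ ((decompositionDataOfChart R ι𝒢).vertGp v₁) ⊓
          conjSubgroup γ₂ ((decompositionDataOfChart R ι𝒢).vertGp v₂) ⊓ augG.ker ≠ ⊥ →
        ∃ (w₁ w₂ : ℋ.graph.Vertex) (x₁ x₂ : Htp),
          conjSubgroup x₁ ((decompositionDataOfChart R' ιℋ).vertGp w₁) ⊓ augH'.ker ≠
              conjSubgroup x₂ ((decompositionDataOfChart R' ιℋ).vertGp w₂) ⊓ augH'.ker ∧
          MapsOntoOpenSubgroupOf ιg
            ((conjSubgroup γ₁ ((decompositionDataOfChart R ι𝒢).vertGp v₁) ⊓ augG.ker).subgroupOf augG.ker)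
            (conjSubgroup x₁ ((decompositionDataOfChart R' ιℋ).vertGp w₁) ⊓ augH'.ker) ∧
          MapsOntoOpenSubgroupOf ιg
            ((conjSubgroup γ₂ ((decompositionDataOfChart R ι𝒢).vertGp v₂) ⊓ augG.ker).subgroupOf augG.ker)
            (conjSubgroup x₂ ((decompositionDataOfChart R' ιℋ).vertGp w₂) ⊓ augH'.ker)) :=
  iotaShadows_of_compatVAt h𝒢iii hℋiii h𝒢 hℋ R R' ι𝒢 ιℋ hι𝒢 hιℋ hιℋe augG augH' hex𝒢 hexℋ A𝒢 F φ hF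
    (fun v ψ ψ' hψ hψ' => F.conj_of_chartPullbackWith_iso θ c𝒢 cℋ φ hφ v ψ ψ' hψ hψ')
    (fun e ψ ψ' hψ hψ' => F.conj_of_chartPullbackWith_iso_edge θ c𝒢 cℋ φ hφ e ψ ψ' hψ hψ') ιg hιg

/-! ### The junction binder `hCor39c`, last line included -/

/-- **`hCor39c` from the dictionary** (the junction binder of the umbrella, verbatim shape, LAST LINE INCLUDED): a
continuous `f : Π^temp_𝔊 → Π^temp_ℍ` over `A` with the three kernel-level shadows restricts on the geometric tempered
groups to a homomorphism induced, up to twist, by a LOCALLY OPEN `F : 𝔾 → ℍ'` (abc-iut-w4-d083's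
`exists_hom_chartPullbackWith_iso_of_kernelShadows`, Cor. 3.9 (b) at the pair); if the dictionary `dict` is FULL on
locally open arrows up to 2-isomorphism at the chosen 2-cells, that `F` is `dict g` for some `g`, and by Prop 3.2
(`BTemp.exists_conj_of_natTrans`) `f = γ_h ∘ ι g` on `Ker aug_𝔊` for some `h ∈ Ker aug_ℍ = ι_ℍ(π₁^temp ℍ')`.
Modulo Thm 3.7 (iii) at `𝔾` and at `ℍ'`. [cite: MochizukiSemiAnbd2006, Thm 5.4 (iii), p. 66] -/
theorem hCor39c_of_dict [TopologicalSpace Gtp] [TopologicalSpace Htp] [IsTopologicalGroup Htp]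
    (h𝒢iii : CompactInVerticialAt 𝒢) (hℋiii : CompactInVerticialAt ℋ) (h𝒢 : Cor39Hypotheses 𝒢)
    (hℋ : Cor39Hypotheses ℋ) (R : ChartRepresentatives c𝒢) (R' : ChartRepresentatives cℋ)
    (ι𝒢 : c𝒢.G →* Gtp) (ιℋ : cℋ.G →* Htp) (hι𝒢 : Function.Injective ι𝒢) (hι𝒢c : Continuous ι𝒢)
    (hιℋ : Function.Injective ιℋ) (hιℋe : IsEmbedding ιℋ)
    (augG : Gtp →* PA) (augH' : Htp →* PA) (hex𝒢 : ι𝒢.range = augG.ker) (hexℋ : ιℋ.range = augH'.ker)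
    {actV : PA → ℋ.graph.Vertex → ℋ.graph.Vertex} {actE : PA → ℋ.graph.Edge → ℋ.graph.Edge}
    {actB : PA → ℋ.graph.Branch → ℋ.graph.Branch} (Aℋ : ArithChartAction cℋ ιℋ augH' actV actE actB)
    (dict : I → Hom 𝒢 ℋ) (θd : ∀ i, (dict i).ConjugatorFamily) (φ : I → (c𝒢.G →ₜ* cℋ.G))
    (hφ : ∀ i, Nonempty ((dict i).chartPullbackWith (θd i) c𝒢 cℋ ≅ BTemp.res (φ i)))
    (hfull : ∀ F : Hom 𝒢 ℋ, F.IsLocallyOpen → ∀ θ : F.ConjugatorFamily,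
      ∃ i, Nonempty ((dict i).chartPullbackWith (θd i) c𝒢 cℋ ≅ F.chartPullbackWith θ c𝒢 cℋ))
    (ι : I → (augG.ker →* Htp)) (hι : ∀ (i : I) (x : augG.ker) (y : c𝒢.G), (x : Gtp) = ι𝒢 y → ι i x = ιℋ (φ i y))
    (f : Gtp →* Htp) (hf : Continuous f) (hover : augH'.comp f = augG)
    (h1 : ∀ v : 𝒢.graph.Vertex, ∃ (w : ℋ.graph.Vertex) (x : Htp),
      MapsOntoOpenSubgroupOf f ((decompositionDataOfChart R ι𝒢).vertGp v ⊓ augG.ker)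
        (conjSubgroup x ((decompositionDataOfChart R' ιℋ).vertGp w) ⊓ augH'.ker))
    (h2 : ∀ b : 𝒢.graph.Branch, ∃ (b' : ℋ.graph.Branch) (x : Htp),
      MapsOntoOpenSubgroupOf f ((decompositionDataOfChart R ι𝒢).brGp b ⊓ augG.ker)
        (conjSubgroup x ((decompositionDataOfChart R' ιℋ).brGp b') ⊓ augH'.ker))
    (h3 : ∀ (v₁ v₂ : 𝒢.graph.Vertex) (γ₁ γ₂ : Gtp),
      conjSubgroup γ₁ ((decompositionDataOfChart R ι𝒢).vertGp v₁) ⊓ augG.ker ≠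
          conjSubgroup γ₂ ((decompositionDataOfChart R ι𝒢).vertGp v₂) ⊓ augG.ker →
      conjSubgroup γ₁ ((decompositionDataOfChart R ι𝒢).vertGp v₁) ⊓
          conjSubgroup γ₂ ((decompositionDataOfChart R ι𝒢).vertGp v₂) ⊓ augG.ker ≠ ⊥ →
        ∃ (w₁ w₂ : ℋ.graph.Vertex) (x₁ x₂ : Htp),
          conjSubgroup x₁ ((decompositionDataOfChart R' ιℋ).vertGp w₁) ⊓ augH'.ker ≠
              conjSubgroup x₂ ((decompositionDataOfChart R' ιℋ).vertGp w₂) ⊓ augH'.ker ∧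
          (conjSubgroup γ₁ ((decompositionDataOfChart R ι𝒢).vertGp v₁) ⊓ augG.ker).map f ≤
              conjSubgroup x₁ ((decompositionDataOfChart R' ιℋ).vertGp w₁) ∧
          (conjSubgroup γ₂ ((decompositionDataOfChart R ι𝒢).vertGp v₂) ⊓ augG.ker).map f ≤
              conjSubgroup x₂ ((decompositionDataOfChart R' ιℋ).vertGp w₂)) :
    ∃ i : I, ∃ h ∈ augH'.ker, ∀ x : augG.ker, f x = h * ι i x * h⁻¹ := by
  obtain ⟨f', hf', F, hFlo, θ, ⟨eF⟩⟩ :=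
    exists_hom_chartPullbackWith_iso_of_kernelShadows h𝒢iii hℋiii h𝒢 hℋ R R' ι𝒢 ιℋ hι𝒢 hι𝒢c hιℋ hιℋe
      augG augH' hex𝒢 hexℋ Aℋ f hf hover h1 h2 h3
  obtain ⟨i, ⟨ei⟩⟩ := hfull F hFlo θ
  obtain ⟨eφ⟩ := hφ i
  obtain ⟨k, hk, -⟩ := BTemp.exists_conj_of_natTrans cℋ.isTempered (φ i) f' (eφ.symm ≪≫ ei ≪≫ eF).hom
  refine ⟨i, ιℋ k, ?_, fun x => ?_⟩
  · rw [← hexℋ]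
    exact ⟨k, rfl⟩
  · obtain ⟨y, hy⟩ : (x : Gtp) ∈ ι𝒢.range := by
      rw [hex𝒢]
      exact x.2
    rw [hι i x y hy.symm, ← hy, ← hf' y, ← hk y, map_mul, map_mul, map_inv]

/-! ### Injectivity `hιinj` -/

omit [TopologicalSpace PA] in
/-- **`hιinj` from the dictionary**: if `ι g₁` and `ι g₂` are conjugate by an element of `Ker aug_ℍ = ι_ℍ(π₁^temp ℍ')`,
then `φ̂ g₁`, `φ̂ g₂` are conjugate in `π₁^temp(ℍ')`, so `B^temp(φ̂ g₁) ≅ B^temp(φ̂ g₂)` (`BTemp.resIsoOfConj`), so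
`(dict g₁)^* ≅ (dict g₂)^*` at the chosen 2-cells, and FAITHFULNESS of the dictionary up to 2-isomorphism gives
`g₁ = g₂`. [cite: MochizukiSemiAnbd2006, Thm 5.4 (iii), p. 66] -/
theorem hιinj_of_dict (ι𝒢 : c𝒢.G →* Gtp) (ιℋ : cℋ.G →* Htp) (hιℋ : Function.Injective ιℋ)
    (augG : Gtp →* PA) (augH' : Htp →* PA) (hex𝒢 : ι𝒢.range = augG.ker) (hexℋ : ιℋ.range = augH'.ker)
    (dict : I → Hom 𝒢 ℋ) (θd : ∀ i, (dict i).ConjugatorFamily) (φ : I → (c𝒢.G →ₜ* cℋ.G))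
    (hφ : ∀ i, Nonempty ((dict i).chartPullbackWith (θd i) c𝒢 cℋ ≅ BTemp.res (φ i)))
    (hfaith : ∀ i j, Nonempty ((dict i).chartPullbackWith (θd i) c𝒢 cℋ ≅
      (dict j).chartPullbackWith (θd j) c𝒢 cℋ) → i = j)
    (ι : I → (augG.ker →* Htp)) (hι : ∀ (i : I) (x : augG.ker) (y : c𝒢.G), (x : Gtp) = ι𝒢 y → ι i x = ιℋ (φ i y))
    (i j : I) (h : ∃ δ ∈ augH'.ker, ∀ x : augG.ker, ι i x = δ * ι j x * δ⁻¹) : i = j := by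
  obtain ⟨δ, hδ, hconj⟩ := h
  rw [← hexℋ] at hδ
  obtain ⟨k, rfl⟩ := hδ
  have hmem : ∀ y : c𝒢.G, ι𝒢 y ∈ augG.ker := fun y => by
    rw [← hex𝒢]
    exact ⟨y, rfl⟩
  have hk : ∀ y, k * φ j y * k⁻¹ = φ i y := by
    intro y
    apply hιℋ
    have h := hconj ⟨ι𝒢 y, hmem y⟩
    rw [hι i _ y rfl, hι j _ y rfl] at h
    rw [map_mul, map_mul, map_inv]
    exact h.symm
  obtain ⟨eφi⟩ := hφ i
  obtain ⟨eφj⟩ := hφ j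
  exact hfaith i j ⟨eφi ≪≫ (BTemp.resIsoOfConj (φ j) (φ i) k hk).symm ≪≫ eφj.symm⟩

/-! ### The arithmetic twists `hιG` / `hιH` -/

omit [TopologicalSpace PA] in
/-- **`hιG` from the dictionary**: if the dictionary carries a functoriality 2-isomorphism
`(dict (ρ_𝔾(a) ≫ g))^* ≅ (dict g)^* ⋙ (F_𝔾 a)^*` with the graph action `F_𝔾 : Π_A → Hom 𝔾 𝔾` (Def 5.1 (i)), and
conjugation by `γ ∈ Π^temp_𝔊` on `ι_𝔾(π₁^temp 𝔾)` represents `(F_𝔾 (aug γ))^*` (Prop 3.6 (iv) at `ρ_𝔾(aug γ)`; the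
Hom-level form of `ArithChartAction.conj_verticial`), then `ι (ρ_𝔾(a) ≫ g) = γ_δ ∘ ι g ∘ γ_γ` on `Ker aug_𝔊` for some
`δ ∈ Ker aug_ℍ` — by pasting the isomorphisms to `B^temp(φ̂ (ρ_𝔾(a) ≫ g)) ≅ B^temp(φ̂ g ∘ c_γ)` (`BTemp.resComp`) and Prop 3.2
(`BTemp.exists_conj_of_natTrans`). [cite: MochizukiSemiAnbd2006, Thm 5.4 (iii), p. 66] -/
theorem hιG_of_dict (ι𝒢 : c𝒢.G →* Gtp) (ιℋ : cℋ.G →* Htp)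
    (augG : Gtp →* PA) (augH' : Htp →* PA) (hex𝒢 : ι𝒢.range = augG.ker) (hexℋ : ιℋ.range = augH'.ker)
    (dict : I → Hom 𝒢 ℋ) (θd : ∀ i, (dict i).ConjugatorFamily) (φ : I → (c𝒢.G →ₜ* cℋ.G))
    (hφ : ∀ i, Nonempty ((dict i).chartPullbackWith (θd i) c𝒢 cℋ ≅ BTemp.res (φ i)))
    (F𝒢 : PA → Hom 𝒢 𝒢) (θ𝒢 : ∀ a, (F𝒢 a).ConjugatorFamily)
    (hact𝒢 : ∀ γ : Gtp, ∃ cγ : c𝒢.G →ₜ* c𝒢.G, (∀ y, ι𝒢 (cγ y) = γ * ι𝒢 y * γ⁻¹) ∧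
      Nonempty ((F𝒢 (augG γ)).chartPullbackWith (θ𝒢 (augG γ)) c𝒢 c𝒢 ≅ BTemp.res cγ))
    (pre : PA → I → I)
    (hpre : ∀ (a : PA) (i : I), Nonempty ((dict (pre a i)).chartPullbackWith (θd (pre a i)) c𝒢 cℋ ≅
      (dict i).chartPullbackWith (θd i) c𝒢 cℋ ⋙ (F𝒢 a).chartPullbackWith (θ𝒢 a) c𝒢 c𝒢))
    (ι : I → (augG.ker →* Htp)) (hι : ∀ (i : I) (x : augG.ker) (y : c𝒢.G), (x : Gtp) = ι𝒢 y → ι i x = ιℋ (φ i y))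
    (i : I) (a : PA) (γ : Gtp) (hγ : augG γ = a) :
    ∃ δ ∈ augH'.ker, ∀ x : augG.ker,
      ι (pre a i) x = δ * ι i ⟨γ * x * γ⁻¹, (MonoidHom.normal_ker augG).conj_mem _ x.2 γ⟩ * δ⁻¹ := by
  subst hγ
  obtain ⟨cγ, hcγ, ⟨eγ⟩⟩ := hact𝒢 γ
  obtain ⟨e₁⟩ := hφ (pre (augG γ) i)
  obtain ⟨e₂⟩ := hφ i
  obtain ⟨e₁₂⟩ := hpre (augG γ) i
  obtain ⟨k, hk, -⟩ := BTemp.exists_conj_of_natTrans cℋ.isTempered (φ (pre (augG γ) i)) ((φ i).comp cγ)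
    (e₁.symm ≪≫ e₁₂ ≪≫ Functor.isoWhiskerRight e₂ _ ≪≫ Functor.isoWhiskerLeft _ eγ ≪≫
      BTemp.resComp (φ i) cγ).hom
  refine ⟨ιℋ k⁻¹, ?_, fun x => ?_⟩
  · rw [← hexℋ]
    exact ⟨k⁻¹, rfl⟩
  · obtain ⟨y, hy⟩ : (x : Gtp) ∈ ι𝒢.range := by
      rw [hex𝒢]
      exact x.2
    have hy' : ((⟨γ * x * γ⁻¹, (MonoidHom.normal_ker augG).conj_mem _ x.2 γ⟩ : augG.ker) : Gtp) =
        ι𝒢 (cγ y) := by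
      rw [hcγ, hy]
    rw [hι _ x y hy.symm, hι i _ (cγ y) hy', ← ContinuousMonoidHom.comp_toFun, ← hk y, map_mul, map_mul,
      map_inv]
    group

omit [TopologicalSpace PA] in
/-- **`hιH` from the dictionary**: the mirror statement for post-composition with the graph action `F_ℍ` of `Π_A` on
`ℍ'` (`(dict (g ≫ ρ_ℍ(a)))^* ≅ (F_ℍ a)^* ⋙ (dict g)^*`) and conjugation by `η ∈ Π^temp_ℍ` on `ι_ℍ(π₁^temp ℍ')`:
`ι (g ≫ ρ_ℍ(a)) = γ_δ ∘ γ_η ∘ ι g` on `Ker aug_𝔊` for `aug_ℍ η = a` and some `δ ∈ Ker aug_ℍ`.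
[cite: MochizukiSemiAnbd2006, Thm 5.4 (iii), p. 66] -/
theorem hιH_of_dict (ι𝒢 : c𝒢.G →* Gtp) (ιℋ : cℋ.G →* Htp)
    (augG : Gtp →* PA) (augH' : Htp →* PA) (hex𝒢 : ι𝒢.range = augG.ker) (hexℋ : ιℋ.range = augH'.ker)
    (dict : I → Hom 𝒢 ℋ) (θd : ∀ i, (dict i).ConjugatorFamily) (φ : I → (c𝒢.G →ₜ* cℋ.G))
    (hφ : ∀ i, Nonempty ((dict i).chartPullbackWith (θd i) c𝒢 cℋ ≅ BTemp.res (φ i)))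
    (Fℋ : PA → Hom ℋ ℋ) (θℋ : ∀ a, (Fℋ a).ConjugatorFamily)
    (hactℋ : ∀ η : Htp, ∃ cη : cℋ.G →ₜ* cℋ.G, (∀ z, ιℋ (cη z) = η * ιℋ z * η⁻¹) ∧
      Nonempty ((Fℋ (augH' η)).chartPullbackWith (θℋ (augH' η)) cℋ cℋ ≅ BTemp.res cη))
    (post : PA → I → I)
    (hpost : ∀ (a : PA) (i : I), Nonempty ((dict (post a i)).chartPullbackWith (θd (post a i)) c𝒢 cℋ ≅
      (Fℋ a).chartPullbackWith (θℋ a) cℋ cℋ ⋙ (dict i).chartPullbackWith (θd i) c𝒢 cℋ))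
    (ι : I → (augG.ker →* Htp)) (hι : ∀ (i : I) (x : augG.ker) (y : c𝒢.G), (x : Gtp) = ι𝒢 y → ι i x = ιℋ (φ i y))
    (i : I) (a : PA) (η : Htp) (hη : augH' η = a) :
    ∃ δ ∈ augH'.ker, ∀ x : augG.ker, ι (post a i) x = δ * (η * ι i x * η⁻¹) * δ⁻¹ := by
  subst hη
  obtain ⟨cη, hcη, ⟨eη⟩⟩ := hactℋ η
  obtain ⟨e₁⟩ := hφ (post (augH' η) i)
  obtain ⟨e₂⟩ := hφ i
  obtain ⟨e₁₂⟩ := hpost (augH' η) i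
  obtain ⟨k, hk, -⟩ := BTemp.exists_conj_of_natTrans cℋ.isTempered (φ (post (augH' η) i)) (cη.comp (φ i))
    (e₁.symm ≪≫ e₁₂ ≪≫ Functor.isoWhiskerRight eη _ ≪≫ Functor.isoWhiskerLeft _ e₂ ≪≫
      BTemp.resComp cη (φ i)).hom
  refine ⟨ιℋ k⁻¹, ?_, fun x => ?_⟩
  · rw [← hexℋ]
    exact ⟨k⁻¹, rfl⟩
  · obtain ⟨y, hy⟩ : (x : Gtp) ∈ ι𝒢.range := by
      rw [hex𝒢]
      exact x.2
    rw [hι _ x y hy.symm, hι i x y hy.symm, ← hcη, ← ContinuousMonoidHom.comp_toFun, ← hk y, map_mul,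
      map_mul, map_inv]
    group

/-! ### `hιbtemp` in chart currency -/

omit [TopologicalSpace PA] in
/-- **`hιbtemp` from its chart-currency form**: if the arithmetic `B^temp(φ)` restricts on `ι_𝔾(π₁^temp 𝔾)` to
`ι_ℍ ∘ φ̂` up to `Ker(aug_ℍ)`-conjugacy, then it restricts to `ι g` up to the same conjugacy for any `ι g` agreeing with
`φ̂` through the embeddings (the compatibility requirement on the producer of `B^temp`, Thm 5.4 (iii) p. 66 with
Prop 5.2 (iv)). [cite: MochizukiSemiAnbd2006, Thm 5.4 (iii), p. 66] -/
theorem hιbtemp_of_charts (ι𝒢 : c𝒢.G →* Gtp) (ιℋ : cℋ.G →* Htp) (augG : Gtp →* PA) (augH' : Htp →* PA)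
    (hex𝒢 : ι𝒢.range = augG.ker) {φ : c𝒢.G →* cℋ.G} (ιg : augG.ker →* Htp)
    (hιg : ∀ (x : augG.ker) (y : c𝒢.G), (x : Gtp) = ι𝒢 y → ιg x = ιℋ (φ y)) (B : Gtp →* Htp)
    (hB : ∃ δ ∈ augH'.ker, ∀ y : c𝒢.G, B (ι𝒢 y) = δ * ιℋ (φ y) * δ⁻¹) :
    ∃ δ ∈ augH'.ker, ∀ x : augG.ker, B x = δ * ιg x * δ⁻¹ := by
  obtain ⟨δ, hδ, hBδ⟩ := hB
  refine ⟨δ, hδ, fun x => ?_⟩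
  obtain ⟨y, hy⟩ : (x : Gtp) ∈ ι𝒢.range := by
    rw [hex𝒢]
    exact x.2
  rw [hιg x y hy.symm, ← hy, hBδ y]

end ProfiniteSemiGraph

end Literature.AnabelianGeometry.SemiGraphs
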